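import Literature.Topology.CoveringSpaces.UniversalCoverGroup
import Literature.Topology.CoveringSpaces.UniversalCoverCompact
import Mathlib.SetTheory.Cardinal.Finite
import HarnessLib

/-!
# The kernel of the universal covering homomorphism `p : G̃ →* G`

Topic `Literature/Topology/CoveringSpaces`.  Continuation of `UniversalCoverGroup.lean` (the
group `G̃ = UniversalCover G 1` and `projHom : G̃ →* G`) and `UniversalCoverCompact.lean`
(finite / discrete fibres, central discrete normal subgroups): M. R. Sepanski, *Compact Lie
Groups* (2007), Thm. 1.22 (2), (4): "If `π` is the covering map and `Z̃ = ker π`, then `Z̃` is a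
discrete central subgroup of `G̃` … `π₁(G) ≅ Z̃`."  Everything is proved; there are no
definitions and no named facts.

* `UniversalCover.coe_ker_projHom` — `ker p = p⁻¹(1)`; `mem_ker_projHom_iff_mem_orbit` — `ker p`
  is the deck orbit of `1̃`.
* `UniversalCover.bijective_smul_base` — **`π₁(G, 1) → ker p`, `α ↦ α • 1̃`, is a bijection**
  (the deck action is free with orbits the fibres; Sepanski Thm. 1.22 (4) as a bijection — the
  group isomorphism needs the identification of the deck action with multiplication by `ker p`,
  not done here); `natCard_ker_projHom : |ker p| = |π₁(G, 1)|`, `finite_ker_projHom`,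
  `ker_projHom_eq_bot_iff` (`ker p = ⊥ ↔ π₁(G, 1)` trivial).
* `UniversalCover.t2Space` — the universal cover of a Hausdorff (path connected, strongly locally
  contractible) space is Hausdorff; `isClosed_ker_projHom`.
* `UniversalCover.isDiscrete_ker_projHom`, `discreteTopology_ker_projHom`,
  **`ker_projHom_le_center`**, `mul_comm_of_mem_ker` — for `G` path connected and strongly
  locally contractible, `ker p` is discrete (a fibre of the covering `p`) and central (Sepanski
  Lemma 1.21 in the path connected group `G̃`).

## References

* M. R. Sepanski, *Compact Lie Groups*, GTM 235, Springer 2007, Lemma 1.21, Thm. 1.22. [Sepanski2007]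
* A. Hatcher, *Algebraic Topology*, CUP 2002, §1.3 Prop. 1.39. [HatcherAT2002]
-/

noncomputable section

open Set Filter Topology TopologicalSpace

namespace Literature.Topology.CoveringSpaces

universe u

namespace UniversalCover

/-! ### The universal cover of a Hausdorff space is Hausdorff -/

section Separation

variable {X : Type u} [TopologicalSpace X] {x₀ : X}

/-- **The universal cover of a Hausdorff space is Hausdorff** (for `X` path connected and
strongly locally contractible): two points in different fibres are separated by the preimages of
separating open sets of `X`, two points in the same fibre by the sheets of the covering map `p`
(Mathlib's `IsCoveringMap.isSeparatedMap`). [folklore] -/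
theorem t2Space [T2Space X] [PathConnectedSpace X] [StronglyLocallyContractibleSpace X] :
    T2Space (UniversalCover X x₀) := by
  refine ⟨fun a b hne => ?_⟩
  by_cases h : proj a = proj b
  · exact isCoveringMap_proj.isSeparatedMap a b h hne
  · obtain ⟨u, v, hu, hv, hau, hbv, huv⟩ := t2_separation h
    exact ⟨proj ⁻¹' u, proj ⁻¹' v, hu.preimage continuous_proj, hv.preimage continuous_proj, hau,
      hbv, huv.preimage proj⟩

end Separation

variable {G : Type u} [TopologicalSpace G] [Group G] [IsTopologicalGroup G]

/-- Membership in `ker p`: `a ∈ ker p ↔ p a = 1`. [folklore] -/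
theorem mem_ker_projHom_iff {a : UniversalCover G (1 : G)} :
    a ∈ (projHom (G := G)).ker ↔ proj a = 1 :=
  MonoidHom.mem_ker

/-- `ker p = p⁻¹(1)` as sets. [folklore] -/
theorem coe_ker_projHom :
    ((projHom (G := G)).ker : Set (UniversalCover G (1 : G))) = proj ⁻¹' {1} := rfl

/-- `ker p` is the deck orbit of the base point `1̃` (orbits = fibres, Hatcher 2002, §1.3
Prop. 1.39). [cite: HatcherAT2002, §1.3 Prop. 1.39] -/
theorem mem_ker_projHom_iff_mem_orbit {a : UniversalCover G (1 : G)} :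
    a ∈ (projHom (G := G)).ker ↔ a ∈ MulAction.orbit (FundamentalGroup G (1 : G)) (base G 1) := by
  rw [mem_ker_projHom_iff, ← proj_eq_iff_mem_orbit, proj_base]

/-- The deck translates `α • 1̃` of the base point lie in `ker p`. [cite: HatcherAT2002, §1.3 Prop. 1.39] -/
theorem smul_base_mem_ker (α : FundamentalGroup G (1 : G)) : α • base G 1 ∈ (projHom (G := G)).ker :=
  mem_ker_projHom_iff_mem_orbit.2 ⟨α, rfl⟩

/-- **`π₁(G, 1) → ker p`, `α ↦ α • 1̃`, is a bijection** (Sepanski 2007, Thm. 1.22 (4):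
"`π₁(G) ≅ Z̃ = ker π`"; here as the bijection given by the free deck action, whose orbit through
`1̃` is `p⁻¹(1) = ker p`). [cite: Sepanski2007, Thm. 1.22] -/
theorem bijective_smul_base :
    Function.Bijective fun α : FundamentalGroup G (1 : G) =>
      (⟨α • base G 1, smul_base_mem_ker α⟩ : (projHom (G := G)).ker) :=
  ⟨fun α β h => IsCancelSMul.right_cancel α β (base G 1) (congrArg Subtype.val h),
    fun a => by
      obtain ⟨α, hα⟩ := mem_ker_projHom_iff_mem_orbit.1 a.2
      exact ⟨α, Subtype.ext hα⟩⟩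

/-- `π₁(G, 1)` and `ker p` are in bijection. [cite: Sepanski2007, Thm. 1.22] -/
theorem nonempty_equiv_ker_projHom :
    Nonempty (FundamentalGroup G (1 : G) ≃ (projHom (G := G)).ker) :=
  ⟨Equiv.ofBijective _ bijective_smul_base⟩

/-- `|ker p| = |π₁(G, 1)|` (as `Nat.card`). [cite: Sepanski2007, Thm. 1.22] -/
theorem natCard_ker_projHom :
    Nat.card (projHom (G := G)).ker = Nat.card (FundamentalGroup G (1 : G)) :=
  (Nat.card_congr (Equiv.ofBijective _ bijective_smul_base)).symm

/-- **`ker p` is trivial iff `π₁(G, 1)` is trivial.** [cite: Sepanski2007, Thm. 1.22] -/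
theorem ker_projHom_eq_bot_iff :
    (projHom (G := G)).ker = ⊥ ↔ Subsingleton (FundamentalGroup G (1 : G)) := by
  rw [Subgroup.eq_bot_iff_forall, (Equiv.ofBijective _ bijective_smul_base).subsingleton_congr,
    subsingleton_iff]
  constructor
  · intro h a b
    exact Subtype.ext ((h a a.2).trans (h b b.2).symm)
  · intro h a ha
    exact congrArg Subtype.val (h ⟨a, ha⟩ ⟨1, Subgroup.one_mem _⟩)

/-- `ker p ≠ ⊥` iff `π₁(G, 1)` is non-trivial. [cite: Sepanski2007, Thm. 1.22] -/
theorem ker_projHom_ne_bot_iff :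
    (projHom (G := G)).ker ≠ ⊥ ↔ Nontrivial (FundamentalGroup G (1 : G)) := by
  rw [Ne, ker_projHom_eq_bot_iff, not_subsingleton_iff_nontrivial]

/-- **`ker p` is finite when `π₁(G, 1)` is finite** (a fibre of `p`, `finite_preimage_proj_singleton`).
[cite: Sepanski2007, Thm. 1.22] -/
theorem finite_ker_projHom [Finite (FundamentalGroup G (1 : G))] :
    ((projHom (G := G)).ker : Set (UniversalCover G (1 : G))).Finite := by
  rw [coe_ker_projHom]
  exact finite_preimage_proj_singleton 1

/-- **`ker p` is discrete** (a fibre of the covering map `p`; Sepanski 2007, Thm. 1.22 (2)), for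
`G` path connected and strongly locally contractible. [cite: Sepanski2007, Thm. 1.22] -/
theorem isDiscrete_ker_projHom [PathConnectedSpace G] [StronglyLocallyContractibleSpace G] :
    IsDiscrete ((projHom (G := G)).ker : Set (UniversalCover G (1 : G))) := by
  rw [coe_ker_projHom]
  exact isDiscrete_preimage_proj_singleton 1

/-- `ker p` carries the discrete topology (a theorem, to be introduced with `haveI`).
[cite: Sepanski2007, Thm. 1.22] -/
theorem discreteTopology_ker_projHom [PathConnectedSpace G]
    [StronglyLocallyContractibleSpace G] : DiscreteTopology (projHom (G := G)).ker :=
  SetLike.isDiscrete_iff_discreteTopology.1 isDiscrete_ker_projHom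

/-- `ker p` is closed when `G` is `T₁`. [folklore] -/
theorem isClosed_ker_projHom [T1Space G] :
    IsClosed ((projHom (G := G)).ker : Set (UniversalCover G (1 : G))) := by
  rw [coe_ker_projHom]
  exact isClosed_preimage_proj_singleton 1

/-- **`ker p` is central** (Sepanski 2007, Thm. 1.22 (2): a discrete normal subgroup of the
connected group `G̃` is central by Lemma 1.21; `G̃` is path connected, `UniversalCoverLift.lean`),
for `G` path connected and strongly locally contractible. [cite: Sepanski2007, Thm. 1.22] -/
theorem ker_projHom_le_center [PathConnectedSpace G] [StronglyLocallyContractibleSpace G] :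
    (projHom (G := G)).ker ≤ Subgroup.center (UniversalCover G (1 : G)) :=
  Subgroup.le_center_of_isDiscrete _ isDiscrete_ker_projHom

/-- Elements of `ker p` commute with every element of `G̃`. [cite: Sepanski2007, Thm. 1.22] -/
theorem mul_comm_of_mem_ker [PathConnectedSpace G] [StronglyLocallyContractibleSpace G]
    {k : UniversalCover G (1 : G)} (hk : k ∈ (projHom (G := G)).ker)
    (a : UniversalCover G (1 : G)) : k * a = a * k :=
  (Subgroup.mem_center_iff.1 (ker_projHom_le_center hk) a).symm

end UniversalCover

end Literature.Topology.CoveringSpaces
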